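import Mathlib

/-!
# Route «KPlusLogSqLaw», crux `WeakLifting` (stmt-ValiantsHypothesis-19561) — REAL side of the tridiagonal sector:
# the RELAXED WORD GAME of the hierarchical limit (definitions)

HONEST FRAMING.  Definitions file (D-0009: reviewed) for the helper line (`--supports stmt-ValiantsHypothesis-19561 --as helper`) on
the REAL side of the witness-plan stub `stub_tridiagonalSectorB` (`Cruxes/WeakLifting/Lines/birth.lean`), static definite symmetric
tridiagonal sub-sector, «α register».  Seat val-sym-lift-p3 (g10), cell `pub-symmetroid`, 2026-08-27; companion of
`…TridiagonalRealStaticPotentialDefs` (the potential `theta`, root words, conjecture (P)).  It names, and asserts NOTHING about, the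
COMBINATORIAL MODEL of the seat memo HIERARCHICAL-LIMIT-GAME-liftp3g9.md §1/§3b:
in the hierarchical LIMIT of the sector (each new edge infinitely faster than all previous ones) a new edge acts on the root word
`w = u ++ v` of `(D_{k−1}, D_k)` (letters `false` = «p» = zeros of the older continuant, `true` = «q»), cut at the switch point, by
`w ↦ φ(u) ++ T ++ ψ(v)` (type I; type II is the mirror image): `φ` deletes the letters `p` of `u` and turns each `q` into a TIGHT PAIR `pq` or
`qp` (the zero of `D_k`, now the older continuant, next to its displaced copy), `T ∈ {[], [q]}` is the transition zero at the cut, and `ψ`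
swaps the letters of `v` (zeros of `D_k` right of the cut survive as `p`, zeros of `D_{k−1}` are replaced by their copies, now `q`).  The
RELAXED game frees every pair orientation and the presence of `T` — a super-game: every play of the sign-forced limit game is a relaxed play.
* `agreements w l`, `changes l` — list-level bookkeeping through which the potential `theta` of the companion file is evaluated on label
  LISTS (`#{i : w i = l i}` and `#{i : l i ≠ l (i+1)}`);
* `pairWord u o` (`φ`, orientations `o`), `swapWord v` (`ψ`), `IsRelaxedMove w w'` (type I or II), `RelaxedReach n w` (reachable from the
  empty word — the root word of `(D₀, D₁)` — in `n` relaxed moves).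
The proof file `…PotentialGame` proves the CAP `Θ(w') ≤ Θ(w) + 2` per relaxed move and `#q(w) ≤ 2n` after `n` moves (memo §3b's theorem
«every play has `Z(p_m) ≤ 2m − 2`», previously on paper + exhaustive machine check to 6 moves).  The FAITHFULNESS of the game to finite
designs (first-order displacement signs, one transition zero) is the located/paper part of the memo and is NOT claimed in the kernel.
Nothing here bears on `WeakLifting` / `TropicalB` (stmt-19771) in their windows, on Conjecture B, on the Door-A registers, on
`MatrixDescartes` (stmt-ValiantsHypothesis-18050) or on VP ≠ VNP.

[this cell's memo HIERARCHICAL-LIMIT-GAME-liftp3g9.md §1/§3b; folklore (words, labelings)]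
-/

-- `Summit.ValiantsHypothesis.ValiantsHypothesis.…` repeats a component by the D-0017 layout (single-conjunct summit); the name is mandated.
set_option linter.dupNamespace false
set_option autoImplicit false

namespace Summit.ValiantsHypothesis.ValiantsHypothesis.Theorems.KPlusLogSqLaw

namespace StaticTridiagonalRealPotential

/-- Positionwise AGREEMENTS of a word with a label list (surplus letters of either list are ignored); for `l = List.ofFn lab` this is the
agreement count `#{i : w i = lab i}` of the potential `theta`. [bookkeeping] -/
def agreements : List Bool → List Bool → ℕ
  | a :: w, b :: l => (if a = b then 1 else 0) + agreements w l
  | _, _ => 0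

/-- Number of CHANGES between consecutive labels of a label list; for `l = List.ofFn lab` this is the change count
`#{i : lab i ≠ lab (i+1)}` of the potential `theta`. [bookkeeping] -/
def changes : List Bool → ℕ
  | a :: b :: l => (if a = b then 0 else 1) + changes (b :: l)
  | _ => 0

/-- The TIGHT-PAIR WORD `φ(u)` of the relaxed word game: delete the letters `false` («p»); replace each letter `true` («q») by the tight pair
`[false, true]` or `[true, false]` according to the orientation sequence `o`, read at the position of the letter in `u`.
[this cell's memo HIERARCHICAL-LIMIT-GAME-liftp3g9.md §3b] -/
def pairWord : List Bool → (ℕ → Bool) → List Bool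
  | [], _ => []
  | false :: u, o => pairWord u (fun n => o (n + 1))
  | true :: u, o => (if o 0 then [false, true] else [true, false]) ++ pairWord u (fun n => o (n + 1))

/-- The LETTER SWAP `ψ(v)` of the relaxed word game. [memo §3b] -/
def swapWord (v : List Bool) : List Bool := v.map (fun b => !b)

/-- One move of the RELAXED WORD GAME: type I `w = u ++ v ↦ φ(u) ++ T ++ ψ(v)` with `T ∈ {[], [true]}` and free orientations `o`, or its
mirror image, type II (`w = reverse (u ++ v) ↦ reverse (φ(u) ++ T ++ ψ(v))`). [this cell's memo HIERARCHICAL-LIMIT-GAME-liftp3g9.md §3b] -/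
def IsRelaxedMove (w w' : List Bool) : Prop :=
  ∃ (u v : List Bool) (o : ℕ → Bool) (T : List Bool), (T = [] ∨ T = [true]) ∧
    ((w = u ++ v ∧ w' = pairWord u o ++ T ++ swapWord v) ∨
      (w = (u ++ v).reverse ∧ w' = (pairWord u o ++ T ++ swapWord v).reverse))

/-- Words reachable from the empty word (the root word of `(D₀, D₁)`) in `n` relaxed moves. [memo §3b] -/
def RelaxedReach : ℕ → List Bool → Prop
  | 0, w => w = []
  | n + 1, w' => ∃ w, RelaxedReach n w ∧ IsRelaxedMove w w'

end StaticTridiagonalRealPotential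

end Summit.ValiantsHypothesis.ValiantsHypothesis.Theorems.KPlusLogSqLaw
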